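/-
Copyright: derived here (Resolution Observatory cell `pub-rosobs`, carver gen 56). AI-written Lean; AI review is weaker than expert
review.  Companion file of the cell's POLYNOMIAL weighted-centre model `W(f)`: the WEIGHT ARITHMETIC of engine 1's THEOREM F♯♯
(THEOREM-FC-eng1-g37 §5 (1)–(4); CARVER-NOTES-eng1-g37 T50, T50b, T51), with the degree `ρ` and `w* = pρ` SYMBOLIC.
Instrument — NOT a resolution theorem and NOT a statement about the invariant of [AbramovichTemkinWlodarczyk2024].
-/
import Mathlib.Data.Rat.Defs
import Mathlib.Data.Finset.Basic
import Mathlib.Algebra.Order.Field.Basic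
import Mathlib.Tactic.Linarith
import Mathlib.Tactic.NormNum
import Mathlib.Tactic.IntervalCases
import Mathlib.Tactic.Positivity
import Mathlib.Tactic.Ring
import Mathlib.Tactic.FieldSimp
import Mathlib.Data.Nat.Prime.Basic
import HarnessLib

/-!
# THEOREM F♯♯ — the weight arithmetic of the no-carry regime `1/(6p) < ρ ≤ 1/(5(p+1))`

Uniform value line: INSTRUMENT — kernel-checked WEIGHT ARITHMETIC for the polynomial weighted-centre model `W(f)` of the cell
(engine 1's toy model: THEOREM-FC-eng1-g37 §5, census tool `fsharp37.py`; CARVER-NOTES-eng1-g37 T50/T50b/T51) — NOT a resolution theorem,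
NOT a statement about the Abramovich–Temkin–Włodarczyk invariant, NOT summit progress; AI-written Lean, AI review is weaker than expert
review.

Everything is SYMBOLIC in the degree `r = ρ` and in `u = w* = p ρ` (and in `p` where it occurs): the statements hold on the whole regime,
replacing the census tool's 652-point grid.

## Dictionary

* `regime_facts` : for `7 ≤ p` and `1/(6p) < r ≤ 1/(5(p+1))`: `1/6 < u = p r`, `u + r ≤ 1/5`, `0 < r ≤ 1/40` — the only facts about
  `p, r` used below, which are therefore stated with the hypotheses `1/6 < u` (or `1/6 ≤ u`, covering the ENDPOINT `r = 1/(6p)` of §5 (4)),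
  `u ≤ 1/5`, `0 < r ≤ 1/40`;
* `U = {5/24, 2/9, 1/4, 1/3, 1/2}` (classes `F′? no: N, N′, W, M, V`; T9 LEMMA G), `SlotWt u x := (u ≤ x ≤ 1/5) ∨ x ∈ U` — a legal slot
  weight that is `≥ w* = u` ((R0)); "dense" is the first alternative;
* §5 (1) "`V, M, W` are `D`-constant": the targets `1/4 − r`, `1/3 − r`, `1/2 − r` are NOT a slot weight (`not_slotWt_quarter_sub`,
  `…third…`, `…half…`), NOT a sum of two slot weights (`two_slots_ge_third`, `not_pair_half_sub`), NOT a sum of `≥ 3` slot weights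
  (`three_slots_ge_half`) — valid for `1/6 ≤ u`, hence also the heavy-class part of the endpoint analysis §5 (4);
* §5 (2)–(3) "the order bound": with `n ≥ 1` LIGHT factors of weights in `[u, 2/9]` and total light weight `L`, `n u ≤ L ≤ 2n/9`;
  `light_count_bounds` (`9L/2 ≤ n < 6L`), the per-`L` determinations `light_count_one` (`n = 5`), `…three_quarters` (`4`), `…two_thirds`
  (`3`), `…five_twelfths` (`2`), the impossibilities `light_count_half/third/quarter`, `light_count_le_sixth`; the heavy census
  `heavy_census` (`1 − (a/4 + b/3 + c/2) ∈ {1, 3/4, 2/3, 1/2, 5/12, 1/3, 1/4, 1/6, 1/12, 0}`); and the packaged strict bound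
  **`order_sum_lt`**: `L < (n + 1) u`, i.e. (`order_bound_div`, `u = p r`) `L/r − n p < p` — "`Σ o ≤ L/ρ − np < p` on every value-1
  monomial", the no-carry conclusion of §5 (3) modulo LEMMA C;
* §5 (4), integer part (`floor_facts`, `three_dense_ne`): `4⌊p/4⌋ ≤ p − 1`, `2⌊p/4⌋ + ⌊p/2⌋ ≤ p − 1`, `⌊p/4⌋ + ⌊3p/4⌋ = p − 1`,
  `5⌊p/5⌋ ≤ p − 1` for `4 ∤ p`, `5 ∤ p`, and three naturals `≤ 6p/5` never sum to `4p`;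
* T51 (`sq_mul_gt_half`): `5 ≤ p`, `1/(6p) < r` ⇒ `p² r > 1/2`.

NOT here (engine's modelling): LEMMA S / LEMMA C (carries and orders `o(f)`), the induction `o(f) ≤ (w_f − w*)/ρ`, the emission rules,
the per-pattern floor sums of §5 (4) beyond the integer facts above, and §10.

References (context only; elementary arithmetic decided here): [AbramovichTemkinWlodarczyk2024] §5 (weights of a weighted centre);
[Wlodarczyk2022] (weighted centres in arbitrary characteristic).
-/

namespace Literature.AlgebraicGeometry.Resolution.WeightedBlowup

namespace FrobeniusWall

/-! ## §0 The regime in terms of `r = ρ` and `u = w* = p ρ` -/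

/-- The regime `7 ≤ p`, `1/(6p) < r ≤ 1/(5(p+1))` in terms of `u = p r`: `1/6 < u`, `u + r ≤ 1/5`, `0 < r ≤ 1/40` (derived here).
[cite: AbramovichTemkinWlodarczyk2024, §5] -/
theorem regime_facts {p r : ℚ} (hp : 7 ≤ p) (h1 : 1 / (6 * p) < r) (h2 : r ≤ 1 / (5 * (p + 1))) :
    1/6 < p * r ∧ p * r + r ≤ 1/5 ∧ 0 < r ∧ r ≤ 1/40 := by
  have hp0 : 0 < p := by linarith
  have h1' : 1 < r * (6 * p) := (div_lt_iff₀ (by positivity)).mp h1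
  have h2' : r * (5 * (p + 1)) ≤ 1 := (le_div_iff₀ (by positivity)).mp h2
  have e1 : r * (6 * p) = 6 * (p * r) := by ring
  have e2 : r * (5 * (p + 1)) = 5 * (p * r) + 5 * r := by ring
  rw [e1] at h1'
  rw [e2] at h2'
  have h40 : 1 / (5 * (p + 1)) ≤ 1 / 40 := one_div_le_one_div_of_le (by norm_num) (by linarith)
  have hr0 : 0 < 1 / (6 * p) := by positivity
  exact ⟨by linarith, by linarith, by linarith, h2.trans h40⟩

/-- At the ENDPOINT `r = 1/(6p)` (`7 ≤ p`): `u = p r = 1/6`, `0 < r ≤ 1/42 ≤ 1/40` (derived here; §5 (4)).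
[cite: AbramovichTemkinWlodarczyk2024, §5] -/
theorem endpoint_facts {p r : ℚ} (hp : 7 ≤ p) (h : r = 1 / (6 * p)) : p * r = 1/6 ∧ 0 < r ∧ r ≤ 1/40 := by
  have hp0 : 0 < p := by linarith
  subst h
  refine ⟨by field_simp, by positivity, ?_⟩
  rw [div_le_div_iff₀ (by positivity) (by norm_num)]
  linarith

/-! ## §1 Legal slot weights `≥ w*` -/

/-- `U = {5/24, 2/9, 1/4, 1/3, 1/2}` (the classes `N, N′, W, M, V`; LEMMA G). [cite: AbramovichTemkinWlodarczyk2024, §5] -/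
def U : Finset ℚ := {5/24, 2/9, 1/4, 1/3, 1/2}

/-- Membership in `U`, unfolded. [cite: AbramovichTemkinWlodarczyk2024, §5] -/
theorem mem_U {x : ℚ} : x ∈ U ↔ x = 5/24 ∨ x = 2/9 ∨ x = 1/4 ∨ x = 1/3 ∨ x = 1/2 := by
  simp [U]

/-- A slot weight in the regime: legal (dense `≤ 1/5` or in `U`) and at least `w* = u` ((R0)).
[cite: AbramovichTemkinWlodarczyk2024, §5] -/
def SlotWt (u x : ℚ) : Prop := (u ≤ x ∧ x ≤ 1/5) ∨ x ∈ U

/-- `SlotWt` is decidable (plumbing). [cite: AbramovichTemkinWlodarczyk2024, §5] -/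
instance instDecidableSlotWt (u x : ℚ) : Decidable (SlotWt u x) :=
  inferInstanceAs (Decidable ((_ ∧ _) ∨ _))

/-- Case split of a slot weight (plumbing). [cite: AbramovichTemkinWlodarczyk2024, §5] -/
theorem slotWt_cases {u x : ℚ} (h : SlotWt u x) :
    (u ≤ x ∧ x ≤ 1/5) ∨ x = 5/24 ∨ x = 2/9 ∨ x = 1/4 ∨ x = 1/3 ∨ x = 1/2 := by
  rcases h with h | h
  · exact Or.inl h
  · exact Or.inr (mem_U.mp h)

/-- Every slot weight is `≥ u` when `u ≤ 1/5` (plumbing). [cite: AbramovichTemkinWlodarczyk2024, §5] -/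
theorem le_of_slotWt {u x : ℚ} (hu : u ≤ 1/5) (h : SlotWt u x) : u ≤ x := by
  rcases slotWt_cases h with ⟨h1, -⟩ | h | h | h | h | h <;> linarith

/-! ## §5 (1): `V, M, W` are `D`-constant — the targets `h − r` are not realisable -/

/-- `1/4 − r` is not a slot weight (`0 < r ≤ 1/40`; the coincidences `r = 1/24, 1/36` lie above `1/40`) (derived here).
[cite: AbramovichTemkinWlodarczyk2024, §5] -/
theorem not_slotWt_quarter_sub {u r : ℚ} (hr0 : 0 < r) (hr : r ≤ 1/40) : ¬ SlotWt u (1/4 - r) := by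
  intro h
  rcases slotWt_cases h with ⟨-, h⟩ | h | h | h | h | h <;> linarith

/-- `1/3 − r` is not a slot weight (derived here). [cite: AbramovichTemkinWlodarczyk2024, §5] -/
theorem not_slotWt_third_sub {u r : ℚ} (hr0 : 0 < r) (hr : r ≤ 1/40) : ¬ SlotWt u (1/3 - r) := by
  intro h
  rcases slotWt_cases h with ⟨-, h⟩ | h | h | h | h | h <;> linarith

/-- `1/2 − r` is not a slot weight (derived here). [cite: AbramovichTemkinWlodarczyk2024, §5] -/
theorem not_slotWt_half_sub {u r : ℚ} (hr0 : 0 < r) (hr : r ≤ 1/40) : ¬ SlotWt u (1/2 - r) := by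
  intro h
  rcases slotWt_cases h with ⟨-, h⟩ | h | h | h | h | h <;> linarith

/-- Two slot weights sum to `≥ 1/3` (`1/6 ≤ u ≤ 1/5`), so neither `1/4 − r` nor `1/3 − r` (`r > 0`) is a sum of two (derived here).
[cite: AbramovichTemkinWlodarczyk2024, §5] -/
theorem two_slots_ge_third {u x y : ℚ} (hu : 1/6 ≤ u) (hu5 : u ≤ 1/5) (hx : SlotWt u x) (hy : SlotWt u y) :
    1/3 ≤ x + y := by
  have := le_of_slotWt hu5 hx
  have := le_of_slotWt hu5 hy
  linarith

/-- Three slot weights sum to `≥ 1/2`, so no target `h − r` (`h ≤ 1/2`, `r > 0`) is a sum of three or more (derived here).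
[cite: AbramovichTemkinWlodarczyk2024, §5] -/
theorem three_slots_ge_half {u x y z : ℚ} (hu : 1/6 ≤ u) (hu5 : u ≤ 1/5) (hx : SlotWt u x) (hy : SlotWt u y)
    (hz : SlotWt u z) : 1/2 ≤ x + y + z := by
  have := le_of_slotWt hu5 hx
  have := le_of_slotWt hu5 hy
  have := le_of_slotWt hu5 hz
  linarith

/-- `1/2 − r` is not a sum of two slot weights (`1/6 ≤ u ≤ 1/5`, `0 < r ≤ 1/40`): the `V`-case of §5 (1) — `y = 1/3` forces
`x = 1/6 − r < u`, `y = 1/4` forces the illegal `1/4 − r`, `y ∈ {2/9, 5/24}` forces `x ∈ (1/4, 7/24) ∖ U`, two dense weigh `≤ 2/5`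
(derived here). [cite: AbramovichTemkinWlodarczyk2024, §5] -/
theorem not_pair_half_sub {u r x y : ℚ} (hu : 1/6 ≤ u) (hr0 : 0 < r) (hr : r ≤ 1/40) (hx : SlotWt u x)
    (hy : SlotWt u y) : x + y ≠ 1/2 - r := by
  intro hxy
  rcases slotWt_cases hx with ⟨hx1, hx2⟩ | hx' | hx' | hx' | hx' | hx' <;>
  rcases slotWt_cases hy with ⟨hy1, hy2⟩ | hy' | hy' | hy' | hy' | hy' <;>
  linarith

/-- §5 (1) packaged: for `h ∈ {1/4, 1/3, 1/2}` the target `h − r` is neither one slot weight, nor a sum of two, nor `≤` a sum of three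
(derived here). [cite: AbramovichTemkinWlodarczyk2024, §5] -/
theorem heavy_classes_D_constant {u r : ℚ} (hu : 1/6 ≤ u) (hu5 : u ≤ 1/5) (hr0 : 0 < r) (hr : r ≤ 1/40) {h : ℚ}
    (hh : h = 1/4 ∨ h = 1/3 ∨ h = 1/2) :
    (¬ SlotWt u (h - r)) ∧ (∀ x y, SlotWt u x → SlotWt u y → x + y ≠ h - r) ∧
      (∀ x y z, SlotWt u x → SlotWt u y → SlotWt u z → h - r < x + y + z) := by
  refine ⟨?_, fun x y hx hy => ?_, fun x y z hx hy hz => ?_⟩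
  · rcases hh with rfl | rfl | rfl
    exacts [not_slotWt_quarter_sub hr0 hr, not_slotWt_third_sub hr0 hr, not_slotWt_half_sub hr0 hr]
  · rcases hh with rfl | rfl | rfl
    · have := two_slots_ge_third hu hu5 hx hy; linarith
    · have := two_slots_ge_third hu hu5 hx hy; linarith
    · exact not_pair_half_sub hu hr0 hr hx hy
  · have := three_slots_ge_half hu hu5 hx hy hz
    rcases hh with rfl | rfl | rfl <;> linarith

/-! ## §5 (2)–(3): the count of light factors and the strict order bound -/

/-- `n` light factors of weights in `[u, 2/9]` and total `L > 0`: `9L/2 ≤ n < 6L` (`1/6 < u`) (derived here).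
[cite: AbramovichTemkinWlodarczyk2024, §5] -/
theorem light_count_bounds {u L : ℚ} {n : ℕ} (hu : 1/6 < u) (hL : 0 < L) (h1 : (n : ℚ) * u ≤ L)
    (h2 : L ≤ n * (2/9)) : 9 * L ≤ 2 * n ∧ (n : ℚ) < 6 * L := by
  refine ⟨by linarith, ?_⟩
  rcases Nat.eq_zero_or_pos n with rfl | hn
  · push_cast; linarith
  · have hn' : (0 : ℚ) < n := by exact_mod_cast hn
    have key : (n : ℚ) * 1 < n * (6 * u) := mul_lt_mul_of_pos_left (by linarith) hn'
    have e : (n : ℚ) * (6 * u) = 6 * (n * u) := by ring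
    rw [e] at key
    linarith

/-- `L = 1` (no heavy factor): `n = 5` (derived here). [cite: AbramovichTemkinWlodarczyk2024, §5] -/
theorem light_count_one {u : ℚ} {n : ℕ} (hu : 1/6 < u) (h1 : (n : ℚ) * u ≤ 1) (h2 : (1 : ℚ) ≤ n * (2/9)) : n = 5 := by
  obtain ⟨ha, hb⟩ := light_count_bounds hu one_pos h1 h2
  have h6 : n < 6 := by exact_mod_cast (show (n : ℚ) < 6 by linarith)
  have h5 : 4 < n := by exact_mod_cast (show (4 : ℚ) < n by linarith)
  omega

/-- `L = 3/4` (heavy part `W`): `n = 4` (derived here). [cite: AbramovichTemkinWlodarczyk2024, §5] -/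
theorem light_count_three_quarters {u : ℚ} {n : ℕ} (hu : 1/6 < u) (h1 : (n : ℚ) * u ≤ 3/4)
    (h2 : (3/4 : ℚ) ≤ n * (2/9)) : n = 4 := by
  obtain ⟨ha, hb⟩ := light_count_bounds hu (by norm_num) h1 h2
  have h6 : n < 5 := by exact_mod_cast (show (n : ℚ) < 5 by linarith)
  have h5 : 3 < n := by exact_mod_cast (show (3 : ℚ) < n by linarith)
  omega

/-- `L = 2/3` (heavy part `M`): `n = 3` (derived here). [cite: AbramovichTemkinWlodarczyk2024, §5] -/
theorem light_count_two_thirds {u : ℚ} {n : ℕ} (hu : 1/6 < u) (h1 : (n : ℚ) * u ≤ 2/3)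
    (h2 : (2/3 : ℚ) ≤ n * (2/9)) : n = 3 := by
  obtain ⟨ha, hb⟩ := light_count_bounds hu (by norm_num) h1 h2
  have h6 : n < 4 := by exact_mod_cast (show (n : ℚ) < 4 by linarith)
  have h5 : 2 < n := by exact_mod_cast (show (2 : ℚ) < n by linarith)
  omega

/-- `L = 5/12` (heavy part `M W`): `n = 2` (derived here). [cite: AbramovichTemkinWlodarczyk2024, §5] -/
theorem light_count_five_twelfths {u : ℚ} {n : ℕ} (hu : 1/6 < u) (h1 : (n : ℚ) * u ≤ 5/12)
    (h2 : (5/12 : ℚ) ≤ n * (2/9)) : n = 2 := by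
  obtain ⟨ha, hb⟩ := light_count_bounds hu (by norm_num) h1 h2
  have h6 : n < 3 := by exact_mod_cast (show (n : ℚ) < 3 by linarith)
  have h5 : 1 < n := by exact_mod_cast (show (1 : ℚ) < n by linarith)
  omega

/-- `L = 1/2` (heavy part `V` or `W W`): no `n` (derived here). [cite: AbramovichTemkinWlodarczyk2024, §5] -/
theorem light_count_half {u : ℚ} {n : ℕ} (hu : 1/6 < u) (h1 : (n : ℚ) * u ≤ 1/2) (h2 : (1/2 : ℚ) ≤ n * (2/9)) :
    False := by
  obtain ⟨ha, hb⟩ := light_count_bounds hu (by norm_num) h1 h2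
  have h6 : n < 3 := by exact_mod_cast (show (n : ℚ) < 3 by linarith)
  have h5 : 2 < n := by exact_mod_cast (show (2 : ℚ) < n by linarith)
  omega

/-- `L = 1/3` (heavy part `M M`): no `n` (derived here). [cite: AbramovichTemkinWlodarczyk2024, §5] -/
theorem light_count_third {u : ℚ} {n : ℕ} (hu : 1/6 < u) (h1 : (n : ℚ) * u ≤ 1/3) (h2 : (1/3 : ℚ) ≤ n * (2/9)) :
    False := by
  obtain ⟨ha, hb⟩ := light_count_bounds hu (by norm_num) h1 h2
  have h6 : n < 2 := by exact_mod_cast (show (n : ℚ) < 2 by linarith)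
  have h5 : 1 < n := by exact_mod_cast (show (1 : ℚ) < n by linarith)
  omega

/-- `L = 1/4` (heavy part `V W` or `W W W`): no `n` (derived here). [cite: AbramovichTemkinWlodarczyk2024, §5] -/
theorem light_count_quarter {u : ℚ} {n : ℕ} (hu : 1/6 < u) (h1 : (n : ℚ) * u ≤ 1/4) (h2 : (1/4 : ℚ) ≤ n * (2/9)) :
    False := by
  obtain ⟨ha, hb⟩ := light_count_bounds hu (by norm_num) h1 h2
  have h6 : n < 2 := by exact_mod_cast (show (n : ℚ) < 2 by linarith)
  have h5 : 1 < n := by exact_mod_cast (show (1 : ℚ) < n by linarith)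
  omega

/-- `0 < L ≤ 1/6` (heavy parts `V M`, `W W M`, `W M M`, …): no `n` (derived here). [cite: AbramovichTemkinWlodarczyk2024, §5] -/
theorem light_count_le_sixth {u L : ℚ} {n : ℕ} (hu : 1/6 < u) (hL0 : 0 < L) (hL : L ≤ 1/6) (h1 : (n : ℚ) * u ≤ L)
    (h2 : L ≤ n * (2/9)) : False := by
  obtain ⟨ha, hb⟩ := light_count_bounds hu hL0 h1 h2
  have h6 : n < 1 := by exact_mod_cast (show (n : ℚ) < 1 by linarith)
  have h5 : 0 < n := by exact_mod_cast (show (0 : ℚ) < n by linarith)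
  omega

/-- The strict order bound in `u`-form: `L ≤ (n+1)/6` and `1/6 < u` give `L < (n+1) u` (derived here).
[cite: AbramovichTemkinWlodarczyk2024, §5] -/
theorem order_bound {u L : ℚ} {n : ℕ} (hu : 1/6 < u) (hL : L ≤ ((n : ℚ) + 1) / 6) : L < ((n : ℚ) + 1) * u := by
  have key : ((n : ℚ) + 1) * (1/6) < ((n : ℚ) + 1) * u := mul_lt_mul_of_pos_left (by linarith) (by positivity)
  linarith

/-- … and in the engine's form `Σ o ≤ L/ρ − n p < p` (`u = p r`, `r > 0`) (derived here). [cite: AbramovichTemkinWlodarczyk2024, §5] -/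
theorem order_bound_div {u r p L : ℚ} {n : ℕ} (hr : 0 < r) (hup : u = p * r) (h : L < ((n : ℚ) + 1) * u) :
    L / r - n * p < p := by
  have h' : L / r < ((n : ℚ) + 1) * p := by
    rw [div_lt_iff₀ hr]
    calc L < ((n : ℚ) + 1) * u := h
      _ = ((n : ℚ) + 1) * p * r := by rw [hup]; ring
  linarith

/-- The heavy census: a product of `a` `W`'s, `b` `M`'s and `c` `V`'s of weight `≤ 1` leaves light weight
`L = 1 − (a/4 + b/3 + c/2) ∈ {1, 3/4, 2/3, 1/2, 5/12, 1/3, 1/4, 1/6, 1/12, 0}` (derived here, `60` cases).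
[cite: AbramovichTemkinWlodarczyk2024, §5] -/
theorem heavy_census (a b c : ℕ) (h : (a : ℚ) / 4 + b / 3 + c / 2 ≤ 1) :
    (1 : ℚ) - (a / 4 + b / 3 + c / 2) ∈ ({1, 3/4, 2/3, 1/2, 5/12, 1/3, 1/4, 1/6, 1/12, 0} : Finset ℚ) := by
  have ha0 : (0 : ℚ) ≤ a := a.cast_nonneg
  have hb0 : (0 : ℚ) ≤ b := b.cast_nonneg
  have hc0 : (0 : ℚ) ≤ c := c.cast_nonneg
  have ha : a ≤ 4 := by exact_mod_cast (show (a : ℚ) ≤ 4 by linarith)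
  have hb : b ≤ 3 := by exact_mod_cast (show (b : ℚ) ≤ 3 by linarith)
  have hc : c ≤ 2 := by exact_mod_cast (show (c : ℚ) ≤ 2 by linarith)
  interval_cases a <;> interval_cases b <;> interval_cases c <;>
    norm_num [Finset.mem_insert, Finset.mem_singleton] <;> norm_num at h

/-- **§5 (3), the strict bound on every value-1 monomial** (derived here): a heavy part of `a` `W`'s, `b` `M`'s, `c` `V`'s and
`n ≥ 1` light factors of weights in `[u, 2/9]` with total light weight `L`, `a/4 + b/3 + c/2 + L = 1`, `n u ≤ L ≤ 2n/9`, `1/6 < u`: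
then `L < (n + 1) u`, i.e. `L/ρ − n p < p` (`order_bound_div`) — `Σ o ≤ p − 1`, no carry. [cite: AbramovichTemkinWlodarczyk2024, §5] -/
theorem order_sum_lt {u L : ℚ} (hu : 1/6 < u) {a b c n : ℕ} (hn : 1 ≤ n)
    (hval : (a : ℚ) / 4 + b / 3 + c / 2 + L = 1) (h1 : (n : ℚ) * u ≤ L) (h2 : L ≤ n * (2/9)) :
    L < ((n : ℚ) + 1) * u := by
  have hn' : (1 : ℚ) ≤ n := by exact_mod_cast hn
  have hL0 : 0 < L := by nlinarith
  have hcen := heavy_census a b c (by linarith)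
  have hL : L = 1 - ((a : ℚ) / 4 + b / 3 + c / 2) := by linarith
  rw [← hL] at hcen
  simp only [Finset.mem_insert, Finset.mem_singleton] at hcen
  rcases hcen with rfl | rfl | rfl | rfl | rfl | rfl | rfl | rfl | rfl | rfl
  · obtain rfl := light_count_one hu h1 h2
    exact order_bound hu (by norm_num)
  · obtain rfl := light_count_three_quarters hu h1 h2
    exact order_bound hu (by norm_num)
  · obtain rfl := light_count_two_thirds hu h1 h2
    exact order_bound hu (by norm_num)
  · exact (light_count_half hu h1 h2).elim
  · obtain rfl := light_count_five_twelfths hu h1 h2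
    exact order_bound hu (by norm_num)
  · exact (light_count_third hu h1 h2).elim
  · exact (light_count_quarter hu h1 h2).elim
  · exact (light_count_le_sixth hu (by norm_num) (by norm_num) h1 h2).elim
  · exact (light_count_le_sixth hu (by norm_num) (by norm_num) h1 h2).elim
  · exact absurd hL0 (lt_irrefl 0)

/-! ## §5 (4): the integer facts at the endpoint `ρ = 1/(6p)` -/

/-- The floor facts used pattern by pattern in §5 (4) (`4 ∤ p`, `5 ∤ p`; derived here by `omega`).
[cite: AbramovichTemkinWlodarczyk2024, §5] -/
theorem floor_facts (p : ℕ) (h4 : ¬ 4 ∣ p) (h5 : ¬ 5 ∣ p) :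
    4 * (p / 4) ≤ p - 1 ∧ 2 * (p / 4) + p / 2 ≤ p - 1 ∧ p / 4 + 3 * p / 4 = p - 1 ∧ 5 * (p / 5) ≤ p - 1 := by
  omega

/-- Three dense weights (`≤ 6p/5` in units of `ρ = 1/(6p)`) never sum to `4p` (`p > 0`) (derived here).
[cite: AbramovichTemkinWlodarczyk2024, §5] -/
theorem three_dense_ne (p x y z : ℕ) (hp : 0 < p) (hx : 5 * x ≤ 6 * p) (hy : 5 * y ≤ 6 * p) (hz : 5 * z ≤ 6 * p) :
    x + y + z ≠ 4 * p := by
  omega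

/-- For a prime `p ≥ 7` the divisibility hypotheses hold: `¬ 4 ∣ p`, `¬ 3 ∣ p`, `¬ 5 ∣ p` (plumbing).
[cite: AbramovichTemkinWlodarczyk2024, §5] -/
theorem not_dvd_of_prime {p : ℕ} (hp : p.Prime) (h7 : 7 ≤ p) : ¬ 4 ∣ p ∧ ¬ 3 ∣ p ∧ ¬ 5 ∣ p := by
  refine ⟨fun h => ?_, fun h => ?_, fun h => ?_⟩
  · have := (Nat.dvd_prime hp).mp h; omega
  · have := (Nat.dvd_prime hp).mp h; omega
  · have := (Nat.dvd_prime hp).mp h; omega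

/-! ## T51 -/

/-- `5 ≤ p` and `1/(6p) < r` give `p² r > 1/2` (so `e ≥ 2`, `w* = p² ρ`, is impossible below `1/2`) (derived here).
[cite: AbramovichTemkinWlodarczyk2024, §5] -/
theorem sq_mul_gt_half {p r : ℚ} (hp : 5 ≤ p) (h1 : 1 / (6 * p) < r) : 1/2 < p ^ 2 * r := by
  have hp0 : 0 < p := by linarith
  have h : 1 < r * (6 * p) := (div_lt_iff₀ (by positivity)).mp h1
  have h' : p * 1 < p * (r * (6 * p)) := mul_lt_mul_of_pos_left h hp0
  have e : p * (r * (6 * p)) = 6 * (p ^ 2 * r) := by ring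
  rw [e] at h'
  linarith

end FrobeniusWall

end Literature.AlgebraicGeometry.Resolution.WeightedBlowup
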